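import Summits.HodgeConjecture.HodgeConjecture.Theorems.Ring2WeilCoverageCyclicPlacementB
import HarnessLib

/-!
# Weil-type family coverage — dicyclic placement: the classes of `2^α 3^β 5^γ`, `2^α 3^β 7^δ` for `ℚ(√-2)`, `ℚ(√-11)`, `ℚ(i)`

research route conditional on HC_CM; not a corollary; Q11.4-sentence-2 already refuted in dim ≥ 3.

Ring 2, WEIL-TYPE FAMILY-COVERAGE CENSUS (`HOME/WEIL-FAMILY-COVERAGE.md` `## b04`, block b04.8 «GROUP-PRYM PLACEMENT
round 2: the binary dihedral groups `Dic_n = ⟨a, b ∣ a^{2n} = 1, b² = aⁿ, bab⁻¹ = a⁻¹⟩`», owner ring2-b04). The quaternion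
part `P` of a `Dic_n`-cover is the primitive piece of the CYCLIC `ℤ/2n`-cover `C̃ → C̃/⟨a⟩`, so its polarisation type is
ring2-b04 g43's Theorem T; the definite quaternion algebra `D_n ⊃ ℚ(ζ_{2n})` acting on `P` carries NEW imaginary
quadratic fields `K = ℚ(x)` (`x` a pure quaternion in `ℤ[Dic_n]`, e.g. `x = b`, `K = ℚ(i)`), and for those the placement
law of parts A/B needs the classes decided here:

* §1 a generic two-prime parity lemma `pow_mul_pow_mem_iff_of_not_mem` (`c₁^β c₂^δ ∈ Nm ↔ β, δ` even when `c₁`, `c₂`,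
  `c₁c₂ ∉ Nm`) and the bridge variant `mk_det_eq_splitDiscriminantClass_iff_prod_type_mem_of_index_mem` (part A's (R1)
  with «index a perfect square» relaxed to «index a norm»);
* §2 `K = ℚ(√-2)`: `two_pow_mul_three_pow_mul_five_pow_mem_iff` (`↔ γ` even; `2 = 0² + 2·1²`, `3 = 1² + 2·1²` are norms,
  `5` is not) and `two_pow_mul_three_pow_mul_seven_pow_mem_iff` (`↔ δ` even) — the `Dic₅`-Prym EIGHTFOLD families of type
  `(1⁴, 2³, 10)` lie on `W8.2.5 = (4, ℚ(√-2), [+5])`, the `Dic₇` CM sixfolds of type `(1⁵, 7)` on `W6.2.7`;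
* §3 `K = ℚ(√-11)`: `two_pow_mul_three_pow_mul_seven_pow_mem_iff` (`↔ α` and `δ` even; `2`, `7`, `14 ∉ Nm`) — `Dic₇` CM
  sixfolds on `W6.11.7`;
* §4 `K = ℚ(i)`: `two_pow_mul_three_pow_mul_seven_pow_mem_iff` (`↔ β` and `δ` even; `3`, `7`, `21 ∉ Nm`) — `Dic₇` CM
  sixfolds of type `(1⁵,7)` on `W6.1.7 = (3, ℚ(i), [-7])`, `Dic₉` CM sixfolds of type `(1³,3³)` on `R3 = (3, ℚ(i), [-3])`;
* §5 the corresponding census sentences over part A's bridge.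

All norm facts are REUSED BY NAME (ring2-b02 `Ring2WeilNormObstructionDescentCensus`:
`five/seven_not_mem_norm_two`, `two/seven_not_mem_norm_eleven`, `three/seven/twentyOne_not_mem_norm_one`; ring2-b04 g40
tables: `SqrtNeg2.mem_2/mem_3`, `SqrtNeg11.mem_3/not_mem_14`, `SqrtNeg1.mem_2`). No `def`, no named fact, no `sorry`;
nothing here is a statement about Hodge classes; `HC_CM` is used nowhere.

References: [cite: vanGeemen1994HodgeAV, 5.4 and (5.4.1)]; [cite: Serre1973, Ch. III §1].
-/

set_option linter.dupNamespace false

open Matrix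
open Literature.AlgebraicGeometry.Motives (normUnitsSubgroup)
open Literature.AlgebraicGeometry.VanGeemen1994
open Literature.Geometry.Kaehler.ComplexTorus
open Summit.HodgeConjecture.HodgeConjecture.Ring2.Hypotheses
open Summit.HodgeConjecture.HodgeConjecture.Ring2.AbelianAll (weilStdGramMatrix)
open Summit.HodgeConjecture.Ring2WeilNormDescent

namespace Summit.HodgeConjecture.HodgeConjecture.Ring2.WeilCoverage

/-! ### §1 A generic two-prime parity lemma and the bridge with a norm index -/

/-- If `c₁`, `c₂` and `c₁c₂` are all non-norms from `K_d` (two distinct non-trivial classes), then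
`c₁^β · c₂^δ ∈ Nm(K_dˣ) ↔ β` and `δ` are both even.
research route conditional on HC_CM; not a corollary; Q11.4-sentence-2 already refuted in dim ≥ 3. [cite: Serre1973, Ch. III §1] -/
theorem pow_mul_pow_mem_iff_of_not_mem {d : ℕ} {c₁ c₂ : ℚ} (h₁ : c₁ ≠ 0) (h₂ : c₂ ≠ 0)
    (n₁ : Units.mk0 c₁ h₁ ∉ normUnitsSubgroup ℚ (weilField d))
    (n₂ : Units.mk0 c₂ h₂ ∉ normUnitsSubgroup ℚ (weilField d))
    (n₁₂ : Units.mk0 (c₂ * c₁) (mul_ne_zero h₂ h₁) ∉ normUnitsSubgroup ℚ (weilField d)) (β δ : ℕ) :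
    Units.mk0 (c₁ ^ β * c₂ ^ δ) (mul_ne_zero (pow_ne_zero β h₁) (pow_ne_zero δ h₂)) ∈
        normUnitsSubgroup ℚ (weilField d) ↔ Even β ∧ Even δ := by
  rw [← mk0_mul_mk0 (pow_ne_zero β h₁) (pow_ne_zero δ h₂)]
  rcases Nat.even_or_odd β with hβ | hβ
  · rw [pow_mul_mem_iff_of_even h₁ hβ, pow_mem_normUnitsSubgroup_iff_even _ n₂]
    exact ⟨fun h => ⟨hβ, h⟩, fun h => h.2⟩
  · rw [pow_mul_mem_iff_of_odd h₁ hβ]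
    have hnot : Units.mk0 c₁ h₁ * Units.mk0 (c₂ ^ δ) (pow_ne_zero δ h₂) ∉ normUnitsSubgroup ℚ (weilField d) := by
      have ec : Units.mk0 c₁ h₁ * Units.mk0 (c₂ ^ δ) (pow_ne_zero δ h₂) =
          Units.mk0 (c₂ ^ δ) (pow_ne_zero δ h₂) * Units.mk0 c₁ h₁ := mul_comm _ _
      rw [ec]
      rcases Nat.even_or_odd δ with hδ | hδ
      · rw [pow_mul_mem_iff_of_even h₂ hδ]
        exact n₁
      · rw [pow_mul_mem_iff_of_odd h₂ hδ, mk0_mul_mk0]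
        exact n₁₂
    refine ⟨fun h => (hnot h).elim, fun h => ?_⟩
    exact ((Nat.not_even_iff_odd.mpr hβ) h.1).elim

section Weil

variable {ι : Type*} {E : Type*} [NormedAddCommGroup E] [NormedSpace ℂ E]
  {Φ : (ι → ℝ) ≃L[ℝ] E} {ω : E [⋀^Fin 2]→L[ℝ] ℝ} {g : ℕ} {dtyp : Fin g → ℕ}
  {n d : ℕ} {a b : Matrix (Fin (2 * n)) (Fin (2 * n)) ℚ} {q : ℚ}

/-- **(R1′) — the bridge with a NORM index.** In the setting of the lattice placement law
(`neg_one_pow_mul_det_eq_natAbs_of_frame`), if the index `|det P| = [ℤ^ι : Σⱼ ℤyⱼ]` of the `K`-frame is a NORM from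
`K_d` (e.g. a perfect square, or a square times a norm prime — the `ℤ[x]`-frames of the dicyclic pieces for `x² = -8`,
`-50`, … have such indices), then `[det Ψ] = splitDiscriminantClass n d ↔ d₁⋯d_g ∈ Nm(K_dˣ)`.
research route conditional on HC_CM; not a corollary; Q11.4-sentence-2 already refuted in dim ≥ 3.
[cite: vanGeemen1994HodgeAV, 5.4 and (5.4.1)] -/
theorem mk_det_eq_splitDiscriminantClass_iff_prod_type_mem_of_index_mem (hd : IsPolarizationType Φ ω dtyp)
    (hdpos : 0 < d) (e : Fin (4 * n) ≃ ι) (P : Matrix (Fin (4 * n)) (Fin (4 * n)) ℤ)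
    (hF : (Matrix.of fun j j' =>
        ω ![Φ (intVec fun i => P (e.symm i) j), Φ (intVec fun i => P (e.symm i) j')]) =
      (weilStdGramMatrix n d a b).map (Rat.cast : ℚ → ℝ))
    (ha : a.IsSymm) (hb : bᵀ = -b) (hq : (weilGramMatrix d a b).det = algebraMap ℚ (weilField d) q)
    (hsign : 0 < (-1 : ℚ) ^ n * q) (hq0 : q ≠ 0) (hP : (P.det.natAbs : ℚ) ≠ 0)
    (hidx : Units.mk0 (P.det.natAbs : ℚ) hP ∈ normUnitsSubgroup ℚ (weilField d))
    (hprod : (∏ i, (dtyp i : ℚ)) ≠ 0) :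
    (QuotientGroup.mk (Units.mk0 q hq0) : weilNormResidueGroup d) = splitDiscriminantClass n d ↔
      Units.mk0 (∏ i, (dtyp i : ℚ)) hprod ∈ normUnitsSubgroup ℚ (weilField d) := by
  have hlaw := neg_one_pow_mul_det_eq_natAbs_of_frame hd hdpos e P hF ha hb hq hsign
  have hc0 : (((P.det * ∏ i, (dtyp i : ℤ)).natAbs : ℕ) : ℚ) ≠ 0 := by
    rw [← hlaw]
    exact ne_of_gt hsign
  rw [mk_det_eq_splitDiscriminantClass_iff_of_frame hd hdpos e P hF ha hb hq hsign hq0 hc0]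
  have hu : Units.mk0 (((P.det * ∏ i, (dtyp i : ℤ)).natAbs : ℕ) : ℚ) hc0 =
      Units.mk0 (P.det.natAbs : ℚ) hP * Units.mk0 (∏ i, (dtyp i : ℚ)) hprod :=
    Units.ext (by rw [Units.val_mul, Units.val_mk0, Units.val_mk0, Units.val_mk0, natAbs_det_mul_prod_cast])
  rw [hu]
  exact Subgroup.mul_mem_cancel_left _ hidx

end Weil

/-! ### §2 `K = ℚ(√-2)` with the primes `5` and `7` -/

namespace SqrtNeg2

/-- `2^α · 3^β · 5^γ ∈ Nm(ℚ(√-2)ˣ) ↔ γ` even (`2`, `3` are norms, `5` is inert): the `Dic₅`-Prym eightfold families of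
type `(1,1,1,1,2,2,2,10)` (`2⁴·5`) lie on the NON-split row `W8.2.5 = (4, ℚ(√-2), [+5])`, `T = {2,5}`.
research route conditional on HC_CM; not a corollary; Q11.4-sentence-2 already refuted in dim ≥ 3. [cite: vanGeemen1994HodgeAV, (5.4.1)] -/
theorem two_pow_mul_three_pow_mul_five_pow_mem_iff (α β γ : ℕ) :
    Units.mk0 ((2 : ℚ) ^ α * 3 ^ β * 5 ^ γ)
        (mul_ne_zero (mul_ne_zero (pow_ne_zero α two_ne_zero) (pow_ne_zero β three_ne_zero))
          (pow_ne_zero γ (by norm_num))) ∈ normUnitsSubgroup ℚ (weilField 2) ↔ Even γ := by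
  have e : Units.mk0 ((2 : ℚ) ^ α * 3 ^ β * 5 ^ γ)
        (mul_ne_zero (mul_ne_zero (pow_ne_zero α two_ne_zero) (pow_ne_zero β three_ne_zero))
          (pow_ne_zero γ (by norm_num))) =
      Units.mk0 ((2 : ℚ) ^ α) (pow_ne_zero α two_ne_zero) *
        (Units.mk0 ((3 : ℚ) ^ β) (pow_ne_zero β three_ne_zero) * Units.mk0 ((5 : ℚ) ^ γ) (pow_ne_zero γ (by norm_num))) :=
    Units.ext (by simp only [Units.val_mul, Units.val_mk0]; ring)
  rw [e, pow_mul_mem_iff_of_mem _ mem_2, pow_mul_mem_iff_of_mem _ mem_3]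
  exact pow_mem_normUnitsSubgroup_iff_even _ five_not_mem_norm_two γ

/-- `2^α · 3^β · 7^δ ∈ Nm(ℚ(√-2)ˣ) ↔ δ` even (`7` is inert in `ℚ(√-2)`): the `Dic₇` CM sixfolds of type `(1⁵, 7)`
(genus-7 curves with signature `(0; 4, 4, 14)`) lie on `W6.2.7 = (3, ℚ(√-2), [-7])`, `T = {2,7}`.
research route conditional on HC_CM; not a corollary; Q11.4-sentence-2 already refuted in dim ≥ 3. [cite: vanGeemen1994HodgeAV, (5.4.1)] -/
theorem two_pow_mul_three_pow_mul_seven_pow_mem_iff (α β δ : ℕ) :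
    Units.mk0 ((2 : ℚ) ^ α * 3 ^ β * 7 ^ δ)
        (mul_ne_zero (mul_ne_zero (pow_ne_zero α two_ne_zero) (pow_ne_zero β three_ne_zero))
          (pow_ne_zero δ (by norm_num))) ∈ normUnitsSubgroup ℚ (weilField 2) ↔ Even δ := by
  have e : Units.mk0 ((2 : ℚ) ^ α * 3 ^ β * 7 ^ δ)
        (mul_ne_zero (mul_ne_zero (pow_ne_zero α two_ne_zero) (pow_ne_zero β three_ne_zero))
          (pow_ne_zero δ (by norm_num))) =
      Units.mk0 ((2 : ℚ) ^ α) (pow_ne_zero α two_ne_zero) *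
        (Units.mk0 ((3 : ℚ) ^ β) (pow_ne_zero β three_ne_zero) * Units.mk0 ((7 : ℚ) ^ δ) (pow_ne_zero δ (by norm_num))) :=
    Units.ext (by simp only [Units.val_mul, Units.val_mk0]; ring)
  rw [e, pow_mul_mem_iff_of_mem _ mem_2, pow_mul_mem_iff_of_mem _ mem_3]
  exact pow_mem_normUnitsSubgroup_iff_even _ seven_not_mem_norm_two δ

end SqrtNeg2

/-! ### §3 `K = ℚ(√-11)` with the primes `2` and `7` -/

namespace SqrtNeg11

/-- `2^α · 3^β · 7^δ ∈ Nm(ℚ(√-11)ˣ) ↔ α` and `δ` both even (`3` is a norm; `2`, `7` inert, `14 ∉ Nm`: the classes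
`[2]` (`T = {2,11}`), `[7]` (`T = {7,11}`), `[14]` (`T = {2,7}`) are distinct): the `Dic₇` CM sixfolds of type `(1⁵,7)`
lie on `W6.11.7 = (3, ℚ(√-11), [-7])`.
research route conditional on HC_CM; not a corollary; Q11.4-sentence-2 already refuted in dim ≥ 3. [cite: vanGeemen1994HodgeAV, (5.4.1)] -/
theorem two_pow_mul_three_pow_mul_seven_pow_mem_iff (α β δ : ℕ) :
    Units.mk0 ((2 : ℚ) ^ α * 3 ^ β * 7 ^ δ)
        (mul_ne_zero (mul_ne_zero (pow_ne_zero α two_ne_zero) (pow_ne_zero β three_ne_zero))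
          (pow_ne_zero δ (by norm_num))) ∈ normUnitsSubgroup ℚ (weilField 11) ↔ Even α ∧ Even δ := by
  have e : Units.mk0 ((2 : ℚ) ^ α * 3 ^ β * 7 ^ δ)
        (mul_ne_zero (mul_ne_zero (pow_ne_zero α two_ne_zero) (pow_ne_zero β three_ne_zero))
          (pow_ne_zero δ (by norm_num))) =
      Units.mk0 ((3 : ℚ) ^ β) (pow_ne_zero β three_ne_zero) *
        Units.mk0 ((2 : ℚ) ^ α * 7 ^ δ) (mul_ne_zero (pow_ne_zero α two_ne_zero) (pow_ne_zero δ (by norm_num))) :=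
    Units.ext (by simp only [Units.val_mul, Units.val_mk0]; ring)
  rw [e, pow_mul_mem_iff_of_mem _ mem_3]
  have h14 : Units.mk0 ((7 : ℚ) * 2) (mul_ne_zero (by norm_num) two_ne_zero) ∉ normUnitsSubgroup ℚ (weilField 11) := by
    have e14 : Units.mk0 ((7 : ℚ) * 2) (mul_ne_zero (by norm_num) two_ne_zero) = Units.mk0 (14 : ℚ) (by norm_num) :=
      Units.ext (by simp only [Units.val_mk0]; norm_num)
    rw [e14]
    exact not_mem_14
  exact pow_mul_pow_mem_iff_of_not_mem two_ne_zero (by norm_num) two_not_mem_norm_eleven seven_not_mem_norm_eleven h14 α δ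

end SqrtNeg11

/-! ### §4 `K = ℚ(i)` with the primes `3` and `7` -/

namespace SqrtNeg1

/-- `2^α · 3^β · 7^δ ∈ Nm(ℚ(i)ˣ) ↔ β` and `δ` both even (`2` is a norm; `3`, `7` inert, `21 ∉ Nm`: the classes `[3]`
(`T = {2,3}`, R3), `[7]` (`T = {2,7}`), `[21]` (`T = {3,7}`) are distinct): the `Dic₇` CM sixfolds of type `(1⁵, 7)`
(`x = b`, `ℤ[b] = ℤ[i]`) lie on `W6.1.7 = (3, ℚ(i), [-7])`, the `Dic₉` CM sixfolds of type `(1³, 3³)` on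
`R3 = (3, ℚ(i), [-3])`, the `Dic₃`/`ℤ/12` pieces as before.
research route conditional on HC_CM; not a corollary; Q11.4-sentence-2 already refuted in dim ≥ 3. [cite: vanGeemen1994HodgeAV, (5.4.1)] -/
theorem two_pow_mul_three_pow_mul_seven_pow_mem_iff (α β δ : ℕ) :
    Units.mk0 ((2 : ℚ) ^ α * 3 ^ β * 7 ^ δ)
        (mul_ne_zero (mul_ne_zero (pow_ne_zero α two_ne_zero) (pow_ne_zero β three_ne_zero))
          (pow_ne_zero δ (by norm_num))) ∈ normUnitsSubgroup ℚ (weilField 1) ↔ Even β ∧ Even δ := by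
  have e : Units.mk0 ((2 : ℚ) ^ α * 3 ^ β * 7 ^ δ)
        (mul_ne_zero (mul_ne_zero (pow_ne_zero α two_ne_zero) (pow_ne_zero β three_ne_zero))
          (pow_ne_zero δ (by norm_num))) =
      Units.mk0 ((2 : ℚ) ^ α) (pow_ne_zero α two_ne_zero) *
        Units.mk0 ((3 : ℚ) ^ β * 7 ^ δ) (mul_ne_zero (pow_ne_zero β three_ne_zero) (pow_ne_zero δ (by norm_num))) :=
    Units.ext (by simp only [Units.val_mul, Units.val_mk0]; ring)
  rw [e, pow_mul_mem_iff_of_mem _ mem_2]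
  have h21 : Units.mk0 ((7 : ℚ) * 3) (mul_ne_zero (by norm_num) three_ne_zero) ∉ normUnitsSubgroup ℚ (weilField 1) := by
    have e21 : Units.mk0 ((7 : ℚ) * 3) (mul_ne_zero (by norm_num) three_ne_zero) = Units.mk0 (21 : ℚ) (by norm_num) :=
      Units.ext (by simp only [Units.val_mk0]; norm_num)
    rw [e21]
    exact twentyOne_not_mem_norm_one
  exact pow_mul_pow_mem_iff_of_not_mem three_ne_zero (by norm_num) three_not_mem_norm_one seven_not_mem_norm_one h21 β δ

end SqrtNeg1

/-! ### §5 Census sentences for the dicyclic pieces -/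

section Census

variable {ι : Type*} {E : Type*} [NormedAddCommGroup E] [NormedSpace ℂ E]
  {Φ : (ι → ℝ) ≃L[ℝ] E} {ω : E [⋀^Fin 2]→L[ℝ] ℝ} {g : ℕ} {dtyp : Fin g → ℕ}
  {n : ℕ} {q : ℚ}

/-- **`K = ℚ(i)`, type `2^α 3^β 7^δ`, order-free lattice (e.g. `x = b ∈ Dic_n`, `ℤ[b] = ℤ[i]` a PID): SPLIT iff `β` and
`δ` are both even** — `Dic₇`: type `(1⁵,7)`, `δ = 1` ⟹ NON-split, row `W6.1.7`; `Dic₉`: type `(1³,3³)`, `β = 3` ⟹ R3;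
`Dic₅`-families: `2⁴·5`-types have `β = δ = 0` ⟹ split for `ℚ(i)`.
research route conditional on HC_CM; not a corollary; Q11.4-sentence-2 already refuted in dim ≥ 3. [cite: vanGeemen1994HodgeAV, (5.4.1)] -/
theorem sqrtNeg1_mk_det_eq_split_iff_even_of_type_two_three_seven
    {a b : Matrix (Fin (2 * n)) (Fin (2 * n)) ℚ} (hd : IsPolarizationType Φ ω dtyp)
    (e : Fin (4 * n) ≃ ι) (P : Matrix (Fin (4 * n)) (Fin (4 * n)) ℤ)
    (hF : (Matrix.of fun j j' =>
        ω ![Φ (intVec fun i => P (e.symm i) j), Φ (intVec fun i => P (e.symm i) j')]) =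
      (weilStdGramMatrix n 1 a b).map (Rat.cast : ℚ → ℝ))
    (ha : a.IsSymm) (hb : bᵀ = -b) (hq : (weilGramMatrix 1 a b).det = algebraMap ℚ (weilField 1) q)
    (hsign : 0 < (-1 : ℚ) ^ n * q) (hq0 : q ≠ 0) {w : ℕ} (hidx : P.det.natAbs = w ^ 2)
    {α β δ : ℕ} (htyp : (∏ i, (dtyp i : ℚ)) = 2 ^ α * 3 ^ β * 7 ^ δ) :
    (QuotientGroup.mk (Units.mk0 q hq0) : weilNormResidueGroup 1) = splitDiscriminantClass n 1 ↔ Even β ∧ Even δ := by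
  have hne : (2 : ℚ) ^ α * 3 ^ β * 7 ^ δ ≠ 0 :=
    mul_ne_zero (mul_ne_zero (pow_ne_zero α two_ne_zero) (pow_ne_zero β three_ne_zero))
      (pow_ne_zero δ (by norm_num))
  have hprod : (∏ i, (dtyp i : ℚ)) ≠ 0 := by rw [htyp]; exact hne
  rw [mk_det_eq_splitDiscriminantClass_iff_prod_type_mem_of_index_sq hd (by norm_num) e P hF ha hb hq hsign
    hq0 hidx hprod]
  have hu : Units.mk0 (∏ i, (dtyp i : ℚ)) hprod = Units.mk0 ((2 : ℚ) ^ α * 3 ^ β * 7 ^ δ)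
      (mul_ne_zero (mul_ne_zero (pow_ne_zero α two_ne_zero) (pow_ne_zero β three_ne_zero))
        (pow_ne_zero δ (by norm_num))) := Units.ext htyp
  rw [hu, SqrtNeg1.two_pow_mul_three_pow_mul_seven_pow_mem_iff]

/-- **`K = ℚ(√-2)`, type `2^α 3^β 5^γ`, frame index a NORM: SPLIT iff `γ = v₅(d₁⋯d_g)` even** — the `Dic₅`-Prym
eightfold FAMILIES (`(0; 4,4,10,5)`-type covers of `ℙ¹`, genus 13, one parameter) have type `(1,1,1,1,2,2,2,10)`,
`γ = 1` ⟹ NON-split row `W8.2.5`.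
research route conditional on HC_CM; not a corollary; Q11.4-sentence-2 already refuted in dim ≥ 3. [cite: vanGeemen1994HodgeAV, (5.4.1)] -/
theorem sqrtNeg2_mk_det_eq_split_iff_even_of_type_two_three_five
    {a b : Matrix (Fin (2 * n)) (Fin (2 * n)) ℚ} (hd : IsPolarizationType Φ ω dtyp)
    (e : Fin (4 * n) ≃ ι) (P : Matrix (Fin (4 * n)) (Fin (4 * n)) ℤ)
    (hF : (Matrix.of fun j j' =>
        ω ![Φ (intVec fun i => P (e.symm i) j), Φ (intVec fun i => P (e.symm i) j')]) =
      (weilStdGramMatrix n 2 a b).map (Rat.cast : ℚ → ℝ))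
    (ha : a.IsSymm) (hb : bᵀ = -b) (hq : (weilGramMatrix 2 a b).det = algebraMap ℚ (weilField 2) q)
    (hsign : 0 < (-1 : ℚ) ^ n * q) (hq0 : q ≠ 0) (hP : (P.det.natAbs : ℚ) ≠ 0)
    (hidx : Units.mk0 (P.det.natAbs : ℚ) hP ∈ normUnitsSubgroup ℚ (weilField 2))
    {α β γ : ℕ} (htyp : (∏ i, (dtyp i : ℚ)) = 2 ^ α * 3 ^ β * 5 ^ γ) :
    (QuotientGroup.mk (Units.mk0 q hq0) : weilNormResidueGroup 2) = splitDiscriminantClass n 2 ↔ Even γ := by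
  have hne : (2 : ℚ) ^ α * 3 ^ β * 5 ^ γ ≠ 0 :=
    mul_ne_zero (mul_ne_zero (pow_ne_zero α two_ne_zero) (pow_ne_zero β three_ne_zero))
      (pow_ne_zero γ (by norm_num))
  have hprod : (∏ i, (dtyp i : ℚ)) ≠ 0 := by rw [htyp]; exact hne
  rw [mk_det_eq_splitDiscriminantClass_iff_prod_type_mem_of_index_mem hd (by norm_num) e P hF ha hb hq hsign
    hq0 hP hidx hprod]
  have hu : Units.mk0 (∏ i, (dtyp i : ℚ)) hprod = Units.mk0 ((2 : ℚ) ^ α * 3 ^ β * 5 ^ γ)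
      (mul_ne_zero (mul_ne_zero (pow_ne_zero α two_ne_zero) (pow_ne_zero β three_ne_zero))
        (pow_ne_zero γ (by norm_num))) := Units.ext htyp
  rw [hu, SqrtNeg2.two_pow_mul_three_pow_mul_five_pow_mem_iff]

/-- **`K = ℚ(√-2)`, type `2^α 3^β 7^δ`, frame index a NORM: SPLIT iff `δ` even** — `Dic₇` CM sixfolds of type
`(1⁵, 7)` ⟹ row `W6.2.7`.
research route conditional on HC_CM; not a corollary; Q11.4-sentence-2 already refuted in dim ≥ 3. [cite: vanGeemen1994HodgeAV, (5.4.1)] -/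
theorem sqrtNeg2_mk_det_eq_split_iff_even_of_type_two_three_seven
    {a b : Matrix (Fin (2 * n)) (Fin (2 * n)) ℚ} (hd : IsPolarizationType Φ ω dtyp)
    (e : Fin (4 * n) ≃ ι) (P : Matrix (Fin (4 * n)) (Fin (4 * n)) ℤ)
    (hF : (Matrix.of fun j j' =>
        ω ![Φ (intVec fun i => P (e.symm i) j), Φ (intVec fun i => P (e.symm i) j')]) =
      (weilStdGramMatrix n 2 a b).map (Rat.cast : ℚ → ℝ))
    (ha : a.IsSymm) (hb : bᵀ = -b) (hq : (weilGramMatrix 2 a b).det = algebraMap ℚ (weilField 2) q)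
    (hsign : 0 < (-1 : ℚ) ^ n * q) (hq0 : q ≠ 0) (hP : (P.det.natAbs : ℚ) ≠ 0)
    (hidx : Units.mk0 (P.det.natAbs : ℚ) hP ∈ normUnitsSubgroup ℚ (weilField 2))
    {α β δ : ℕ} (htyp : (∏ i, (dtyp i : ℚ)) = 2 ^ α * 3 ^ β * 7 ^ δ) :
    (QuotientGroup.mk (Units.mk0 q hq0) : weilNormResidueGroup 2) = splitDiscriminantClass n 2 ↔ Even δ := by
  have hne : (2 : ℚ) ^ α * 3 ^ β * 7 ^ δ ≠ 0 :=
    mul_ne_zero (mul_ne_zero (pow_ne_zero α two_ne_zero) (pow_ne_zero β three_ne_zero))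
      (pow_ne_zero δ (by norm_num))
  have hprod : (∏ i, (dtyp i : ℚ)) ≠ 0 := by rw [htyp]; exact hne
  rw [mk_det_eq_splitDiscriminantClass_iff_prod_type_mem_of_index_mem hd (by norm_num) e P hF ha hb hq hsign
    hq0 hP hidx hprod]
  have hu : Units.mk0 (∏ i, (dtyp i : ℚ)) hprod = Units.mk0 ((2 : ℚ) ^ α * 3 ^ β * 7 ^ δ)
      (mul_ne_zero (mul_ne_zero (pow_ne_zero α two_ne_zero) (pow_ne_zero β three_ne_zero))
        (pow_ne_zero δ (by norm_num))) := Units.ext htyp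
  rw [hu, SqrtNeg2.two_pow_mul_three_pow_mul_seven_pow_mem_iff]

/-- **`K = ℚ(√-11)`, type `2^α 3^β 7^δ`, frame index a NORM: SPLIT iff `α` and `δ` are both even** — `Dic₇` CM
sixfolds of type `(1⁵, 7)` ⟹ row `W6.11.7`.
research route conditional on HC_CM; not a corollary; Q11.4-sentence-2 already refuted in dim ≥ 3. [cite: vanGeemen1994HodgeAV, (5.4.1)] -/
theorem sqrtNeg11_mk_det_eq_split_iff_even_of_type_two_three_seven
    {a b : Matrix (Fin (2 * n)) (Fin (2 * n)) ℚ} (hd : IsPolarizationType Φ ω dtyp)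
    (e : Fin (4 * n) ≃ ι) (P : Matrix (Fin (4 * n)) (Fin (4 * n)) ℤ)
    (hF : (Matrix.of fun j j' =>
        ω ![Φ (intVec fun i => P (e.symm i) j), Φ (intVec fun i => P (e.symm i) j')]) =
      (weilStdGramMatrix n 11 a b).map (Rat.cast : ℚ → ℝ))
    (ha : a.IsSymm) (hb : bᵀ = -b) (hq : (weilGramMatrix 11 a b).det = algebraMap ℚ (weilField 11) q)
    (hsign : 0 < (-1 : ℚ) ^ n * q) (hq0 : q ≠ 0) (hP : (P.det.natAbs : ℚ) ≠ 0)
    (hidx : Units.mk0 (P.det.natAbs : ℚ) hP ∈ normUnitsSubgroup ℚ (weilField 11))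
    {α β δ : ℕ} (htyp : (∏ i, (dtyp i : ℚ)) = 2 ^ α * 3 ^ β * 7 ^ δ) :
    (QuotientGroup.mk (Units.mk0 q hq0) : weilNormResidueGroup 11) = splitDiscriminantClass n 11 ↔
      Even α ∧ Even δ := by
  have hne : (2 : ℚ) ^ α * 3 ^ β * 7 ^ δ ≠ 0 :=
    mul_ne_zero (mul_ne_zero (pow_ne_zero α two_ne_zero) (pow_ne_zero β three_ne_zero))
      (pow_ne_zero δ (by norm_num))
  have hprod : (∏ i, (dtyp i : ℚ)) ≠ 0 := by rw [htyp]; exact hne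
  rw [mk_det_eq_splitDiscriminantClass_iff_prod_type_mem_of_index_mem hd (by norm_num) e P hF ha hb hq hsign
    hq0 hP hidx hprod]
  have hu : Units.mk0 (∏ i, (dtyp i : ℚ)) hprod = Units.mk0 ((2 : ℚ) ^ α * 3 ^ β * 7 ^ δ)
      (mul_ne_zero (mul_ne_zero (pow_ne_zero α two_ne_zero) (pow_ne_zero β three_ne_zero))
        (pow_ne_zero δ (by norm_num))) := Units.ext htyp
  rw [hu, SqrtNeg11.two_pow_mul_three_pow_mul_seven_pow_mem_iff]

end Census

end Summit.HodgeConjecture.HodgeConjecture.Ring2.WeilCoverage
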